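import Summits.QuantumFields.BalabanUV.T4Continuum.Support.StarCarrierComponentPairing
import Summits.QuantumFields.BalabanUV.T4Continuum.Support.StarCarrierMasterBudget
import Summits.QuantumFields.BalabanUV.T4Continuum.Support.RegionGaugeColumnsTower

/-!
# T⁴ programme, spine node NE2 (U1a), sub-row Δ1 «NE2⁰-Dirichlet» — (P-W) FOR THE RUNGS `1 ≤ k`: the Gaffney two-level pairing of the
# LOCAL operator after King's compressed planting is `O(N^{−1/2})` in the owner's master currency `Ebud` (file P5b-2, the assembly)

NE2 formalisation swarm `b2b-balaban-t4-ne2-formalise-*`, LEAF PROVER 01 (gen 11), item «P5b» of the (P-W) socket for the rungs `1 ≤ k`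
(owner R43 / NOTE, journal `CLAIMS.log` 2026-08-21 l.23877 / l.23893; «MINE P5b» l.23942; owner ACK l.≈24105 «P5b IS YOURS» — §3 below
follows the row owner's draft v0 `StarCarrierPairingAssembly.v0.owner-draft.lean` (t4-ne2-p1-g15), re-based on this seat's budget file P5b-1).
Inputs BY NAME: leaf-03-g8's P5a `StarCarrierComponentPairing.component_pairing_le` (ONE component, all directions, rate `(√N)⁻¹` against
`√Bc·√Bf`), this seat's P4c `StarCarrierNeumannHessian.first_order_identity_bmask` (the (P-W) pairing IS the sum over the components of P5a's
left-hand sides at `z = zext ν u`, `z′ = zext ν v`) and P5b-1 `StarCarrierMasterBudget` (`√(Σ_ν Bc(zext ν u)) ≤ d·√Ebud u`,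
`√(Σ_ν Bf(zext ν v)) ≤ √(d(d+2))·√Ebud v`, Cauchy–Schwarz over `ν`), leaf-05-g9's B4a `RegionGaugeColumnsTower.inv_sqrt_lev`.

 * §1 `CP5 d R := cGaf R·d·√(d(d+2))`; **`pairing_W_le (hbox : IsCoordBox M S) (hN : 2 ≤ N) (ha : 0 ≤ a) u v`**:
   `‖⟨v, (JKs·Δ_loc(N, 0) − Δ_loc(R·N, 0)·JKs) u⟩‖ ≤ CP5 d R·(√N)⁻¹·√(Ebud N M a S u)·√(Ebud (R·N) M a S v)`.
 * §2 along King's tower (`N = lev L k`, `R = L`, `JpR L M (starP L M S) k = JKs (lev L k) L M S` by `rfl`): `epsP5 d L k := CP5 d L·((√L)⁻¹)^k`,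
   `epsP5_nonneg`, `epsP5_le`, and THE (P-W) SOCKET FOR THE RUNGS `1 ≤ k` in the template shape of owner R43:
   **`hPW1_box (hL : 2 ≤ L) (hbox) (ha : 0 ≤ a) k u v (hk : 1 ≤ k) :
     ‖star v ⬝ᵥ ((JpR k·Δ_loc(lev L k, 0) − Δ_loc(lev L (k+1), 0)·JpR k) *ᵥ u)‖ ≤ epsP5 d L k·√(Ebud (lev L k) M a S u)·√(Ebud (lev L (k+1)) M a S v)`**;
   `hPW1_rate_box` packages `0 ≤ epsP5 d L k ≤ CP5 d L·((√L)⁻¹)^k` for `1 ≤ k` — the two inputs of the owner's splice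
   `RegionLocalPairingCrude.hPW_rate_of_succ` / `hPW_of_succ` (rung `0` is the owner's crude bound `2(1 + a)`); file 3 of leaf-06-g7
   (`RegionBoxStarTowerEnd`, template published l.23805) plugs the spliced socket into B4a's `towerLimitRate_star_renorm_box_of_WPairing`.

HONEST FRAMING (T4-DAG p. 1).  [folklore] bookkeeping over landed modules at MODEL level (`U = 1`, ONE region = a coordinate box, ONE averaging scale,
finite torus, linear layer); constants OURS and crude; the rate `(√N)⁻¹` comes from the wall term of the Neumann direction (P3) and is not claimed sharp;
nothing printed is a hypothesis or a conclusion; `hinjK` / W3 on boxes follow only with file 3; NE2 (U1a) NOT proved; spine PROVED 0/9 unchanged; NOT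
[B9] (3.16)/(3.23)–(3.27)/(3.42) as printed; NOT infinite volume, NOT a mass gap, NOT the Clay problem.  HONEST DEPENDENCY: continuum YM on T⁴ ⇐
BetaPertH ∧ nine spine estimates (0/9 proved); BetaPertH ⇐ (D1) ∧ (D4) ∧ CAP+tail; G-an2-4 gates asym, D1 and NE2/3/4.  No `sorry`.
-/

noncomputable section

open scoped BigOperators ComplexConjugate Matrix Matrix.Norms.L2Operator
open Finset

namespace Summit.QuantumFields.BalabanUV.T4Continuum.StarCarrierPairingAssembly

open Literature.MathematicalPhysics.QuantumFieldTheory.Balaban1983to89.B5Prop11Plancherel (Tor fine)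
open Literature.MathematicalPhysics.QuantumFieldTheory.Balaban1983to89.B5Action121 (sdiff)
open Literature.MathematicalPhysics.QuantumFieldTheory.Balaban1983to89.B5G183RateUnitTower (lev)
open Summit.QuantumFields.BalabanUV.T4Continuum
open Summit.QuantumFields.BalabanUV.T4Continuum.RegionGaugeFixedVector (starReg)
open Summit.QuantumFields.BalabanUV.T4Continuum.RegionStarBoundaryCharges (AtMostOneNeighbour atMostOneNeighbour_of_isCoordBox)
open Summit.QuantumFields.BalabanUV.T4Continuum.RegionGaugeResolventSplit (regionDeltaLoc)
open Summit.QuantumFields.BalabanUV.T4Continuum.RegionLocalInjectedAssembly (Ebud Ebud_nonneg)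
open Summit.QuantumFields.BalabanUV.T4Continuum.DirichletSubregionTowerOf (pidx JpR)
open Summit.QuantumFields.BalabanUV.T4Continuum.DirichletStarVectorTower (starP two_le_lev_succ)
open Summit.QuantumFields.BalabanUV.T4Continuum.AlignedCarrierTrace (starSite)
open Summit.QuantumFields.BalabanUV.T4Continuum.StarCarrierComponents (zext zext_apply_of_not JKs)
open Summit.QuantumFields.BalabanUV.T4Continuum.StarCarrierNeumannPairing (bmask)
open Summit.QuantumFields.BalabanUV.T4Continuum.StarCarrierNeumannHessian (first_order_identity_bmask)
open Summit.QuantumFields.BalabanUV.T4Continuum.StarCarrierComponentPairing (Bc Bf cGaf cGaf_nonneg Bc_nonneg Bf_nonneg component_pairing_le)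
open Summit.QuantumFields.BalabanUV.T4Continuum.StarCarrierMasterBudget (sqrt_sum_coarse_le sqrt_sum_fine_le norm_sum_le_of_sqrt)
open Summit.QuantumFields.BalabanUV.T4Continuum.RegionGaugeColumnsTower (inv_sqrt_lev)
open Summit.QuantumFields.BalabanUV.Beta.GAN24.DirichletBoxTwoLevel (IsCoordBox)
open Summit.QuantumFields.BalabanUV.Beta.GAN24.DirichletBoxPairing (Aop Fop)

variable {d : ℕ}

/-! ## §1 (P-W) at two levels -/

/-- the (P-W) constant `CP5 d R := cGaf R·d·√(d(d + 2))`. [folklore] -/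
def CP5 (d R : ℕ) : ℝ := cGaf R * ((d : ℝ) * Real.sqrt ((d : ℝ) * ((d : ℝ) + 2)))

/-- `0 ≤ CP5`. [folklore] -/
theorem CP5_nonneg (d R : ℕ) : 0 ≤ CP5 d R := by unfold CP5; have := cGaf_nonneg R; positivity

section TwoLevel

variable (N R : ℕ) [NeZero N] [NeZero R] (M : Fin d → ℕ) [hM : ∀ μ, NeZero (M μ)] (S : Tor M → Prop) [DecidablePred S] (a : ℝ)

/-- the sum over the components of P5a's coarse budgets is inside the master budget: `√(Σ_ν Bc (zext ν u)) ≤ d·√Ebud u` (H1, `0 ≤ a`; P5b-1's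
`sqrt_sum_coarse_le` with `Bc` unfolded). [folklore] -/
theorem sqrt_sum_Bc_le (hH : AtMostOneNeighbour N M S) (ha : 0 ≤ a) (u : {b // starReg N M S b} → ℂ) :
    Real.sqrt (∑ ν, Bc N M S ν (zext N M S ν u)) ≤ (d : ℝ) * Real.sqrt (Ebud N M a S u) :=
  sqrt_sum_coarse_le N M S hH ha u

/-- the sum over the components of P5a's fine budgets is inside the master budget: `√(Σ_ν Bf (zext ν v)) ≤ √(d(d+2))·√Ebud v` (H1 at the fine
level, `0 ≤ a`; P5b-1's `sqrt_sum_fine_le` with `Bf` unfolded). [folklore] -/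
theorem sqrt_sum_Bf_le (hH : AtMostOneNeighbour (R * N) M S) (ha : 0 ≤ a) (v : {b // starReg (R * N) M S b} → ℂ) :
    Real.sqrt (∑ ν, Bf N R M S ν (zext (R * N) M S ν v)) ≤ Real.sqrt ((d : ℝ) * ((d : ℝ) + 2)) * Real.sqrt (Ebud (R * N) M a S v) :=
  sqrt_sum_fine_le N R M S hH ha v

/-- **(P-W) AT TWO LEVELS** (coordinate box, `2 ≤ N`, `0 ≤ a`): the two-level pairing of the LOCAL operator after King's compressed planting is
`O(N^{−1/2})` against the master budgets,
`‖⟨v, (JKs·Δ_loc(N, 0) − Δ_loc(R·N, 0)·JKs) u⟩‖ ≤ CP5 d R·(√N)⁻¹·√(Ebud N M a S u)·√(Ebud (R·N) M a S v)` (§3 of the owner's draft v0). [folklore] -/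
theorem pairing_W_le (hbox : IsCoordBox M S) (hN : 2 ≤ N) (ha : 0 ≤ a) (u : {b // starReg N M S b} → ℂ)
    (v : {b // starReg (R * N) M S b} → ℂ) :
    ‖star v ⬝ᵥ ((JKs N R M S * regionDeltaLoc N M 0 S - regionDeltaLoc (R * N) M 0 S * JKs N R M S) *ᵥ u)‖
      ≤ CP5 d R * (Real.sqrt N)⁻¹ * Real.sqrt (Ebud N M a S u) * Real.sqrt (Ebud (R * N) M a S v) := by
  have hH : AtMostOneNeighbour N M S := atMostOneNeighbour_of_isCoordBox N M S hN hbox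
  have hRN : 2 ≤ R * N := le_trans hN (Nat.le_mul_of_pos_left N (Nat.pos_of_ne_zero (NeZero.ne R)))
  have hH' : AtMostOneNeighbour (R * N) M S := atMostOneNeighbour_of_isCoordBox (R * N) M S hRN hbox
  have hc : 0 ≤ cGaf R * (Real.sqrt N)⁻¹ := mul_nonneg (cGaf_nonneg R) (inv_nonneg.mpr (Real.sqrt_nonneg _))
  rw [first_order_identity_bmask N R M S hbox hN u v]
  -- ONE component, all directions: P5a
  have hcomp : ∀ ν ∈ (Finset.univ : Finset (Fin d)),
      ‖(∑ μ ∈ univ.erase ν, star ((Aop N R M μ - Fop N R M μ) *ᵥ zext (R * N) M S ν v)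
          ⬝ᵥ (sdiff (fine N M) (N : ℂ) μ *ᵥ zext N M S ν u))
        + star ((Aop N R M ν - Fop N R M ν) *ᵥ zext (R * N) M S ν v) ⬝ᵥ bmask N M S ν (zext N M S ν u)‖
      ≤ cGaf R * (Real.sqrt N)⁻¹ * (Real.sqrt (Bc N M S ν (zext N M S ν u)) * Real.sqrt (Bf N R M S ν (zext (R * N) M S ν v))) :=
    fun ν _ => component_pairing_le N R M S ν hbox (fun x hx => zext_apply_of_not N M S ν u hx)
      (fun x hx => zext_apply_of_not (R * N) M S ν v hx)
  -- Cauchy–Schwarz over the components: P5b-1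
  have h1 := norm_sum_le_of_sqrt (Finset.univ : Finset (Fin d)) hc (fun ν => Bc_nonneg N M S ν (zext N M S ν u))
    (fun ν => Bf_nonneg N R M S ν (zext (R * N) M S ν v)) hcomp
  have hBc := sqrt_sum_Bc_le N M S a hH ha u
  have hBf := sqrt_sum_Bf_le N R M S a hH' ha v
  calc _ ≤ cGaf R * (Real.sqrt N)⁻¹
          * (Real.sqrt (∑ ν, Bc N M S ν (zext N M S ν u)) * Real.sqrt (∑ ν, Bf N R M S ν (zext (R * N) M S ν v))) := h1
    _ ≤ cGaf R * (Real.sqrt N)⁻¹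
          * (((d : ℝ) * Real.sqrt (Ebud N M a S u)) * (Real.sqrt ((d : ℝ) * ((d : ℝ) + 2)) * Real.sqrt (Ebud (R * N) M a S v))) :=
        mul_le_mul_of_nonneg_left (mul_le_mul hBc hBf (Real.sqrt_nonneg _) (by positivity)) hc
    _ = CP5 d R * (Real.sqrt N)⁻¹ * Real.sqrt (Ebud N M a S u) * Real.sqrt (Ebud (R * N) M a S v) := by rw [CP5]; ring

end TwoLevel

/-! ## §2 (P-W) along King's tower from rung 1 on -/

section Tower

variable (L : ℕ) [NeZero L] (M : Fin d → ℕ) [hM : ∀ μ, NeZero (M μ)] (S : Tor M → Prop) [DecidablePred S] (a : ℝ)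

/-- the (P-W) rate along the tower: `εP5 d L k := CP5 d L·((√L)⁻¹)^k`. [folklore] -/
def epsP5 (d L : ℕ) (k : ℕ) : ℝ := CP5 d L * ((Real.sqrt (L : ℝ))⁻¹) ^ k

/-- `0 ≤ εP5`. [folklore] -/
theorem epsP5_nonneg (d L k : ℕ) : 0 ≤ epsP5 d L k := by
  unfold epsP5; have := CP5_nonneg d L; positivity

/-- `εP5 k ≤ CP5·((√L)⁻¹)^k` (an equality). [folklore] -/
theorem epsP5_le (d L k : ℕ) : epsP5 d L k ≤ CP5 d L * ((Real.sqrt (L : ℝ))⁻¹) ^ k := le_rfl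

/-- **(P-W) ALONG THE TOWER FROM RUNG 1 ON** (coordinate box, `2 ≤ L`, `0 ≤ a`, `1 ≤ k`): the displayed (P-W) socket of the END of record
(`RegionGaugeColumnsTower.towerLimitRate_star_renorm_box_of_WPairing`) at the rungs `k ≥ 1`, with `εW k = εP5 d L k = CP5 d L·((√L)⁻¹)^k`;
rung `0` and the splice are the owner's `RegionLocalPairingCrude.hPW_of_succ` / `hPW_rate_of_succ`. [folklore] -/
theorem hPW1_box (hL : 2 ≤ L) (hbox : IsCoordBox M S) (ha : 0 ≤ a) (k : ℕ)
    (u : pidx L M (starP L M S) k → ℂ) (v : pidx L M (starP L M S) (k + 1) → ℂ) (hk : 1 ≤ k) :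
    ‖star v ⬝ᵥ ((JpR L M (starP L M S) k * regionDeltaLoc (lev L k) M 0 S
        - regionDeltaLoc (lev L (k + 1)) M 0 S * JpR L M (starP L M S) k) *ᵥ u)‖
      ≤ epsP5 d L k * Real.sqrt (Ebud (lev L k) M a S u) * Real.sqrt (Ebud (lev L (k + 1)) M a S v) := by
  obtain ⟨j, rfl⟩ : ∃ j, k = j + 1 := ⟨k - 1, by omega⟩
  have hN : 2 ≤ lev L (j + 1) := two_le_lev_succ L hL j
  have h := pairing_W_le (lev L (j + 1)) L M S a hbox hN ha u v
  rw [epsP5, ← inv_sqrt_lev L (j + 1)]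
  exact h

/-- the same with `hk` first (for `fun k hk u v => …` consumers). [folklore] -/
theorem hPW1_box' (hL : 2 ≤ L) (hbox : IsCoordBox M S) (ha : 0 ≤ a) (k : ℕ) (hk : 1 ≤ k)
    (u : pidx L M (starP L M S) k → ℂ) (v : pidx L M (starP L M S) (k + 1) → ℂ) :
    ‖star v ⬝ᵥ ((JpR L M (starP L M S) k * regionDeltaLoc (lev L k) M 0 S
        - regionDeltaLoc (lev L (k + 1)) M 0 S * JpR L M (starP L M S) k) *ᵥ u)‖
      ≤ epsP5 d L k * Real.sqrt (Ebud (lev L k) M a S u) * Real.sqrt (Ebud (lev L (k + 1)) M a S v) :=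
  hPW1_box L M S a hL hbox ha k u v hk

omit [NeZero L] in
/-- **THE TWO RATE INPUTS OF THE OWNER's SPLICE** (`RegionLocalPairingCrude.hPW_rate_of_succ`): `0 ≤ εP5 d L k` and
`εP5 d L k ≤ CP5 d L·((√L)⁻¹)^k` for `1 ≤ k` (in fact for every `k`). [folklore] -/
theorem hPW1_rate_box :
    (∀ k, 1 ≤ k → 0 ≤ epsP5 d L k) ∧ (∀ k, 1 ≤ k → epsP5 d L k ≤ CP5 d L * ((Real.sqrt (L : ℝ))⁻¹) ^ k) :=
  ⟨fun k _ => epsP5_nonneg d L k, fun k _ => epsP5_le d L k⟩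

end Tower

end Summit.QuantumFields.BalabanUV.T4Continuum.StarCarrierPairingAssembly

end
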